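import Mathlib
import Summits.Ventures.LatticeQCDFlow.TrivializingMaps.TrivializingFlowLocality
import Summits.Ventures.LatticeQCDFlow.TrivializingMaps.TruncatedGeneratorLipschitz
import Summits.Ventures.LatticeQCDFlow.TrivializingMaps.TruncatedGeneratorSupBound
import Summits.Ventures.LatticeQCDFlow.TrivializingMaps.FlowLightConeWeighted
import Literature.Barriers.CriticalPhenomena.LaceExpansionIsingDeconvolutionPartsProofs
import HarnessLib

/-!
# The strong-coupling trivializing map has an exponential light cone, uniformly in the volume

HONEST FRAMING. This venture is about exact (Metropolis-corrected) sampling algorithms for lattice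
gauge theory; figures of merit are autocorrelation/cost numbers at stated couplings and volumes; no
continuum-physics claim. Finite periodic lattices `(ℤ/L)^d`; every constant below is an explicit
expression in `(d, n, B, β, λ)` and does not depend on `L`.

[Luscher2010Trivializing] §3–§4: for `|β| < β₀(d,n,B)` the summed flow action `S̃^G_t = flowActionG B β t`
generates through `Z_t = -∂S̃^G_t` a flow `Φ` of `SU(n)^E` whose time-one map trivializes `β·S_W`
(`StrongCoupling.exists_trivializingFlow_smul_ambWilsonAction`, lean-2; agreement-form locality of `Z`:
`StrongCoupling.linkDeriv_flowActionG_local`). Here: the LIPSCHITZ form of that locality, fed to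
THEOREM L-ω (`IsFlowMap.weightedLightCone`, theory-1 row 83).
§1 weights growing by `≤ λ` per plaquette step grow by `≤ λ^R` across `linkBall R`. §2–3 the order-`k`
colour gradient is Lipschitz (constant `4(k+1) n N₀ θ₁^k`, row 80b) with respect to the links of its
footprint `linkBall (2(k+1)) e` ONLY; weighted form with the factor `λ^{2(k+1)}`. §4 **`K_Z(ω)` and `M_Z`
for THE trivializing flow**: with `r = 2|β|θ₁λ² < 1`,
`ω_e ‖Z_t(ιU)_e − Z_t(ιU')_e‖_F ≤ K_G(λ) max_{e'} ω_{e'}‖U_{e'} − U'_{e'}‖_F`,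
`K_G(λ) = 4nN₀|β|λ²(1−r)⁻² ∑ₐ‖T^a‖_F` (via `∑_k (k+1)r^k = (1−r)⁻²`, reused from the tree as
`SpreadOutIsing.hasSum_coe_add_one_mul_pow`), `M_G = |β|N₀(1−2|β|θ₁)⁻¹ ∑ₐ‖T^a‖_F`.
§5 **THEOREM L-G** (`StrongCoupling.expLightCone_flowG`): for every flow `Φ` of `Z`, `λ ≥ 1` with
`2|β|θ₁λ² < 1`, level function `lvl` (`lvl e ≤ lvl e' + 1` across a plaquette) and inputs agreeing at the
links of level `≥ 1`: `‖(Φ_t V)_e − (Φ_t V')_e‖_F ≤ 2n e^{(nK_G(λ)+M_G)t} λ^{−lvl e}` on `[0,T]`, every `L`;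
`exists_trivializingMap_expLightCone`: a trivializing map of `β S_W` whose output link at plaquette
distance `m` from the modified inputs moves by `≤ 2n e^{nK_G(λ)+M_G} λ^{−m}` — receptive depth
`(nK_G + M_G + log(2n/ε))/log λ` for accuracy `ε`, independent of the volume. Cf. Raz–Sims 2009
(arXiv:0902.0025) Thm. 2 for the exponential light cone of classical lattice dynamics. Tags [ours] unless
marked [folklore]. Authored by theory-1 (pub-lqcd, FANOUT row 28, GEN-17); landed verbatim by custody.
-/

noncomputable section

namespace Summit.Ventures.LatticeQCDFlow.TrivializingMaps

open scoped Matrix Matrix.Norms.Frobenius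
open Literature.MathematicalPhysics.QuantumFieldTheory
open Literature.MathematicalPhysics.QuantumFieldTheory.Luscher2010
open Literature.MathematicalPhysics.QuantumFieldTheory.WilsonFlow (coeConfig coeConfig_apply)
open GradedSeries AnalyticSeries
open Literature.Barriers.CriticalPhenomena.SpreadOutIsing (hasSum_coe_add_one_mul_pow)

local notation "SU[" n "]" => Matrix.specialUnitaryGroup (Fin n) ℂ

variable {d L n : ℕ} [NeZero L]

/-! ## 1. Weights growing by at most `λ` per plaquette step -/

omit [NeZero L] in
/-- If `ω_e ≤ λ ω_{e'}` whenever `e'` shares a plaquette with `e` (`λ ≥ 1`), then `ω_e ≤ λ^R ω_{e'}`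
for every `e'` in the plaquette ball `linkBall R e`. [folklore] -/
theorem weight_le_pow_mul_of_mem_linkBall (ω : Edge d L → ℝ) (hω : ∀ e, 0 < ω e) {lam : ℝ}
    (hlam : 1 ≤ lam) (hωg : ∀ e, ∀ e' ∈ plaqNbhd e, ω e ≤ lam * ω e') :
    ∀ (R : ℕ) (e : Edge d L), ∀ e' ∈ linkBall R e, ω e ≤ lam ^ R * ω e' := by
  intro R
  induction R with
  | zero => intro e e' he'; rw [mem_linkBall_zero] at he'; rw [he', pow_zero, one_mul]
  | succ R ih =>
    intro e e'' he''
    obtain ⟨e', he', h⟩ := (mem_linkBall_succ R e e'').1 he''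
    have h1 : ω e ≤ lam ^ R * ω e' := ih e e' he'
    have hlR : 0 ≤ lam ^ R := pow_nonneg (zero_le_one.trans hlam) R
    rcases h with h | h
    · subst h
      calc ω e ≤ lam ^ R * ω e'' * 1 := by rw [mul_one]; exact h1
        _ ≤ lam ^ R * ω e'' * lam := mul_le_mul_of_nonneg_left hlam (mul_nonneg hlR (hω e'').le)
        _ = lam ^ (R + 1) * ω e'' := by rw [pow_succ]; ring
    · calc ω e ≤ lam ^ R * ω e' := h1
        _ ≤ lam ^ R * (lam * ω e'') := mul_le_mul_of_nonneg_left (hωg e' e'' h) hlR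
        _ = lam ^ (R + 1) * ω e'' := by rw [pow_succ]; ring

omit [NeZero L] in
/-- The weight `λ^{lvl e}` of a level function (`lvl e ≤ lvl e' + 1` across a plaquette) grows by at
most `λ` per plaquette step. [folklore] -/
theorem pow_level_le_mul_of_mem_plaqNbhd {lam : ℝ} (hlam : 1 ≤ lam) (lvl : Edge d L → ℕ)
    (hlvl : ∀ e, ∀ e' ∈ plaqNbhd e, lvl e ≤ lvl e' + 1) :
    ∀ e, ∀ e' ∈ plaqNbhd e, lam ^ lvl e ≤ lam * lam ^ lvl e' := fun e e' he' => by
  rw [← pow_succ']; exact pow_le_pow_right₀ hlam (hlvl e e' he')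

/-! ## 2. The order-`k` gradient is Lipschitz with respect to its footprint only -/

namespace GradedSeries

variable (B : SuBasis n)

/-- **Localized Lipschitz bound for the graded series**: if `‖U_{e'} − U'_{e'}‖_F ≤ M` on the
footprint `linkBall (2(k+1)) e` (only), then `|∂^a_e S̃^{(k)}(ιU) − ∂^a_e S̃^{(k)}(ιU')| ≤ 4(k+1) n N₀ θ₁^k M`
(row 80b's global bound at the hybrid configuration, plus `linkDeriv_series_local`). [ours] -/
theorem abs_linkDeriv_gradedSk_sub_le_of_linkBall (hn : n ≠ 0) (k : ℕ) (e : Edge d L) (a : B.ι)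
    (U U' : GaugeConfig d L SU[n]) {M : ℝ} (hM0 : 0 ≤ M)
    (hM : ∀ e' ∈ linkBall (2 * (k + 1)) e, ‖coeConfig U e' - coeConfig U' e'‖ ≤ M) :
    |linkDeriv e (B.T a) (gradedSk (d := d) (L := L) B k) (coeConfig U)
        - linkDeriv e (B.T a) (gradedSk (d := d) (L := L) B k) (coeConfig U')|
      ≤ 4 * ((k : ℝ) + 1) * n * (N0 d n * theta1 d n B ^ k) * M := by
  classical
  let U'' : GaugeConfig d L SU[n] := fun e' => if e' ∈ linkBall (2 * (k + 1)) e then U' e' else U e'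
  have hU'U'' : ∀ e' ∈ linkBall (2 * (k + 1)) e, U' e' = U'' e' := fun e' he' => by
    simp only [U'', he', if_true]
  have hM'' : ∀ e', ‖coeConfig U e' - coeConfig U'' e'‖ ≤ M := by
    intro e'
    by_cases he' : e' ∈ linkBall (2 * (k + 1)) e
    · have : coeConfig U'' e' = coeConfig U' e' := by simp only [coeConfig_apply, U'', he', if_true]
      rw [this]; exact hM e' he'
    · have : coeConfig U'' e' = coeConfig U e' := by simp only [coeConfig_apply, U'', he', if_false]
      rw [this, sub_self, norm_zero]; exact hM0
  have hloc := linkDeriv_series_local B (1 : ℝ) (contDiff_smul_gradedSk (d := d) (L := L) B 1)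
    (isLuscherSeries_smul_gradedSk B 1) k e a (U := U') (U' := U'') hU'U''
  rw [linkDeriv_const_mul', linkDeriv_const_mul'] at hloc
  simp only [one_pow, one_mul] at hloc
  rw [hloc]
  exact abs_linkDeriv_gradedSk_sub_le B hn k e a U U'' hM0 hM''

/-! ## 3. Weighted form of the per-order bound -/

/-- With a weight `ω` satisfying `ω_e ≤ λ^R ω_{e'}` on `linkBall R e`: if `ω_{e'}‖U_{e'} − U'_{e'}‖_F ≤ M`
everywhere, then `ω_e |∂^a_e S̃^{(k)}(ιU) − ∂^a_e S̃^{(k)}(ιU')| ≤ 4(k+1) n N₀ θ₁^k λ^{2(k+1)} M`. [ours] -/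
theorem weighted_abs_linkDeriv_gradedSk_sub_le (hn : n ≠ 0) (ω : Edge d L → ℝ) (hω : ∀ e, 0 < ω e)
    {lam : ℝ} (hlam : 0 ≤ lam) (hωR : ∀ (R : ℕ) (e : Edge d L), ∀ e' ∈ linkBall R e, ω e ≤ lam ^ R * ω e')
    (k : ℕ) (e : Edge d L) (a : B.ι) (U U' : GaugeConfig d L SU[n]) {M : ℝ} (hM0 : 0 ≤ M)
    (hM : ∀ e', ω e' * ‖coeConfig U e' - coeConfig U' e'‖ ≤ M) :
    ω e * |linkDeriv e (B.T a) (gradedSk (d := d) (L := L) B k) (coeConfig U)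
        - linkDeriv e (B.T a) (gradedSk (d := d) (L := L) B k) (coeConfig U')|
      ≤ 4 * ((k : ℝ) + 1) * n * (N0 d n * theta1 d n B ^ k) * lam ^ (2 * (k + 1)) * M := by
  have hωe : 0 < ω e := hω e
  have hMk : ∀ e' ∈ linkBall (2 * (k + 1)) e, ‖coeConfig U e' - coeConfig U' e'‖ ≤ lam ^ (2 * (k + 1)) * M / ω e := by
    intro e' he'
    rw [le_div_iff₀ hωe]
    calc ‖coeConfig U e' - coeConfig U' e'‖ * ω e ≤ ‖coeConfig U e' - coeConfig U' e'‖ * (lam ^ (2 * (k + 1)) * ω e') :=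
          mul_le_mul_of_nonneg_left (hωR (2 * (k + 1)) e e' he') (norm_nonneg _)
      _ = lam ^ (2 * (k + 1)) * (ω e' * ‖coeConfig U e' - coeConfig U' e'‖) := by ring
      _ ≤ lam ^ (2 * (k + 1)) * M := mul_le_mul_of_nonneg_left (hM e') (pow_nonneg hlam _)
  have hMk0 : 0 ≤ lam ^ (2 * (k + 1)) * M / ω e := by positivity
  have h := abs_linkDeriv_gradedSk_sub_le_of_linkBall B hn k e a U U' hMk0 hMk
  calc ω e * |linkDeriv e (B.T a) (gradedSk (d := d) (L := L) B k) (coeConfig U)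
          - linkDeriv e (B.T a) (gradedSk (d := d) (L := L) B k) (coeConfig U')|
      ≤ ω e * (4 * ((k : ℝ) + 1) * n * (N0 d n * theta1 d n B ^ k) * (lam ^ (2 * (k + 1)) * M / ω e)) :=
        mul_le_mul_of_nonneg_left h hωe.le
    _ = 4 * ((k : ℝ) + 1) * n * (N0 d n * theta1 d n B ^ k) * lam ^ (2 * (k + 1)) * M := by field_simp

end GradedSeries

/-! ## 4. The generator of the strong-coupling trivializing flow: `K_Z(ω)` and `M_Z` -/

namespace StrongCoupling

/-- `K_G(λ) = 4 n N₀ |β| λ² (1 − 2|β|θ₁λ²)⁻² ∑ₐ ‖T^a‖_F`: the weighted Lipschitz modulus of `Z_t = -∂S̃^G_t`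
for weights growing by `≤ λ` per plaquette step (independent of `L` and `t`). [ours] -/
def KG (d n : ℕ) (B : SuBasis n) (β lam : ℝ) : ℝ :=
  4 * n * N0 d n * |β| * lam ^ 2 / (1 - 2 * |β| * theta1 d n B * lam ^ 2) ^ 2 * ∑ a, ‖B.T a‖

/-- `M_G = |β| N₀ (1 − 2|β|θ₁)⁻¹ ∑ₐ ‖T^a‖_F`: the sup bound of `Z_t = -∂S̃^G_t` on `SU(n)^E` (independent of
`L` and `t`). [ours] -/
def MG (d n : ℕ) (B : SuBasis n) (β : ℝ) : ℝ := |β| * N0 d n / (1 - 2 * |β| * theta1 d n B) * ∑ a, ‖B.T a‖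

omit [NeZero L] in
/-- `0 ≤ K_G(λ)`. [ours] -/
theorem KG_nonneg (d n : ℕ) (B : SuBasis n) (β lam : ℝ) : 0 ≤ KG d n B β lam := by
  unfold KG; have := N0_nonneg d n; positivity

omit [NeZero L] in
/-- `0 ≤ M_G` for `|β| < β₀`. [ours] -/
theorem MG_nonneg (hn : n ≠ 0) (B : SuBasis n) {β : ℝ} (hβ : |β| < beta0 d n B) : 0 ≤ MG d n B β := by
  have hq1 : 2 * |β| * theta1 d n B < 1 := two_mul_abs_mul_theta1_lt_one (d := d) hn hβ
  have := N0_nonneg d n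
  exact mul_nonneg (div_nonneg (by positivity) (sub_pos.2 hq1).le) (Finset.sum_nonneg fun a _ => norm_nonneg _)

/-- THEOREM A termwise, with the time clamp: `|σ(t)^k β^{k+1} ∂^a_e S̃^{(k)}(ιV)| ≤ |β| N₀ (2|β|θ₁)^k`.
[ours] -/
theorem abs_clamp_pow_mul_linkDeriv_gradedSk_le (hn : n ≠ 0) (B : SuBasis n) (β t : ℝ) (k : ℕ)
    (V : GaugeConfig d L SU[n]) (e : Edge d L) (a : B.ι) :
    |clamp t ^ k * (β ^ (k + 1) * linkDeriv e (B.T a) (gradedSk (d := d) (L := L) B k) (coeConfig V))|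
      ≤ |β| * N0 d n * (2 * |β| * theta1 d n B) ^ k := by
  rw [abs_mul, abs_mul, abs_pow, abs_pow]
  have h1 : |clamp t| ^ k ≤ (2 : ℝ) ^ k := pow_le_pow_left₀ (abs_nonneg _) (abs_clamp_le t) k
  have h2 := abs_linkDeriv_gradedSk_le B hn k V e a
  have hN : 0 ≤ N0 d n := N0_nonneg d n
  have hθ : 0 ≤ theta1 d n B := zero_le_one.trans (one_le_theta1 d n B)
  calc |clamp t| ^ k * (|β| ^ (k + 1) * |linkDeriv e (B.T a) (gradedSk (d := d) (L := L) B k) (coeConfig V)|)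
      ≤ (2 : ℝ) ^ k * (|β| ^ (k + 1) * (N0 d n * theta1 d n B ^ k)) :=
        mul_le_mul h1 (mul_le_mul_of_nonneg_left h2 (pow_nonneg (abs_nonneg β) _)) (by positivity) (by positivity)
    _ = |β| * N0 d n * (2 * |β| * theta1 d n B) ^ k := by rw [mul_pow, mul_pow, pow_succ]; ring

/-- **`K_Z(ω)` for the strong-coupling trivializing flow, colour components.** For `|β| < β₀`, a
weight with `ω_e ≤ λ^R ω_{e'}` on `linkBall R e` (`λ ≥ 0`) and `r = 2|β|θ₁λ² < 1`: if
`ω_{e'}‖U_{e'} − U'_{e'}‖_F ≤ M` for all links, then for every time `t`, link `e`, colour `a`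
`ω_e |∂^a_e S̃^G_t(ιU) − ∂^a_e S̃^G_t(ιU')| ≤ 4 n N₀ |β| λ² (1−r)⁻² M`. Independent of `L`, `t`. [ours] -/
theorem weighted_abs_linkDeriv_flowActionG_sub_le (hn : n ≠ 0) (B : SuBasis n) {β : ℝ}
    (hβ : |β| < beta0 d n B) (ω : Edge d L → ℝ) (hω : ∀ e, 0 < ω e) {lam : ℝ} (hlam : 0 ≤ lam)
    (hωR : ∀ (R : ℕ) (e : Edge d L), ∀ e' ∈ linkBall R e, ω e ≤ lam ^ R * ω e')
    (hr : 2 * |β| * theta1 d n B * lam ^ 2 < 1) (t : ℝ) (e : Edge d L) (a : B.ι)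
    (U U' : GaugeConfig d L SU[n]) {M : ℝ} (hM0 : 0 ≤ M) (hM : ∀ e', ω e' * ‖coeConfig U e' - coeConfig U' e'‖ ≤ M) :
    ω e * |linkDeriv e (B.T a) (flowActionG (d := d) (L := L) B β t) (coeConfig U)
        - linkDeriv e (B.T a) (flowActionG (d := d) (L := L) B β t) (coeConfig U')|
      ≤ 4 * n * N0 d n * |β| * lam ^ 2 / (1 - 2 * |β| * theta1 d n B * lam ^ 2) ^ 2 * M := by
  set q : ℝ := 2 * |β| * theta1 d n B with hq
  set r : ℝ := q * lam ^ 2 with hr_def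
  set C : ℝ := 4 * n * N0 d n * |β| * lam ^ 2 with hC
  have hθ : 0 ≤ theta1 d n B := zero_le_one.trans (one_le_theta1 d n B)
  have hN : 0 ≤ N0 d n := N0_nonneg d n
  have hq0 : 0 ≤ q := by positivity
  have hq1 : q < 1 := two_mul_abs_mul_theta1_lt_one (d := d) hn hβ
  have hr0 : 0 ≤ r := by positivity
  have hωe : 0 < ω e := hω e
  set f : GaugeConfig d L SU[n] → ℕ → ℝ := fun V k =>
    clamp t ^ k * (β ^ (k + 1) * linkDeriv e (B.T a) (gradedSk (d := d) (L := L) B k) (coeConfig V)) with hf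
  have hterm : ∀ (V : GaugeConfig d L SU[n]) (k : ℕ), |f V k| ≤ |β| * N0 d n * q ^ k := fun V k =>
    abs_clamp_pow_mul_linkDeriv_gradedSk_le hn B β t k V e a
  have hsU : Summable (f U) := (abs_tsum_sub_sum_le_of_geometric hq0 hq1 (hterm U) 0).1
  have hsU' : Summable (f U') := (abs_tsum_sub_sum_le_of_geometric hq0 hq1 (hterm U') 0).1
  -- per-order weighted Lipschitz bound `ω_e |f_k(U) − f_k(U')| ≤ C (k+1) r^k M`
  have hdiff : ∀ k, ω e * |f U k - f U' k| ≤ C * (((k : ℝ) + 1) * r ^ k) * M := by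
    intro k
    have h1 : |clamp t| ^ k ≤ (2 : ℝ) ^ k := pow_le_pow_left₀ (abs_nonneg _) (abs_clamp_le t) k
    have h2 := weighted_abs_linkDeriv_gradedSk_sub_le B hn ω hω hlam hωR k e a U U' hM0 hM
    set D : ℝ := linkDeriv e (B.T a) (gradedSk (d := d) (L := L) B k) (coeConfig U)
        - linkDeriv e (B.T a) (gradedSk (d := d) (L := L) B k) (coeConfig U') with hD
    have h2' : 0 ≤ ω e * |D| := mul_nonneg hωe.le (abs_nonneg _)
    have hsplit : f U k - f U' k = clamp t ^ k * (β ^ (k + 1) * D) := by rw [hD, hf]; ring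
    rw [hsplit, abs_mul, abs_mul, abs_pow, abs_pow]
    calc ω e * (|clamp t| ^ k * (|β| ^ (k + 1) * |D|)) = |clamp t| ^ k * |β| ^ (k + 1) * (ω e * |D|) := by ring
      _ ≤ (2 : ℝ) ^ k * |β| ^ (k + 1) * (4 * ((k : ℝ) + 1) * n * (N0 d n * theta1 d n B ^ k) * lam ^ (2 * (k + 1)) * M) :=
          mul_le_mul (mul_le_mul_of_nonneg_right h1 (pow_nonneg (abs_nonneg β) _)) h2 h2' (by positivity)
      _ = C * (((k : ℝ) + 1) * r ^ k) * M := by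
          rw [hC, hr_def, hq, pow_mul, pow_succ, mul_pow, mul_pow, mul_pow]; ring
  -- the majorant sums to `C (1-r)⁻² M`
  have hgs : HasSum (fun k : ℕ => C * (((k : ℝ) + 1) * r ^ k) * M) (C * (1 / (1 - r) ^ 2) * M) :=
    ((hasSum_coe_add_one_mul_pow hr0 hr).mul_left C).mul_right M
  have hdiff' : ∀ k, |f U k - f U' k| ≤ C * (((k : ℝ) + 1) * r ^ k) * M / ω e := fun k => by
    rw [le_div_iff₀ hωe, mul_comm]; exact hdiff k
  have hsabs : Summable (fun k => |f U k - f U' k|) :=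
    Summable.of_nonneg_of_le (fun k => abs_nonneg _) hdiff' (hgs.summable.div_const (ω e))
  have hsnorm : Summable (fun k => ‖f U k - f U' k‖) := by simpa only [Real.norm_eq_abs] using hsabs
  -- assemble
  rw [linkDeriv_flowActionG_eq hn B hβ t U e a, linkDeriv_flowActionG_eq hn B hβ t U' e a]
  change ω e * |∑' k, f U k - ∑' k, f U' k| ≤ C / (1 - r) ^ 2 * M
  rw [← hsU.tsum_sub hsU']
  calc ω e * |∑' k, (f U k - f U' k)| ≤ ω e * ∑' k, |f U k - f U' k| := by
        refine mul_le_mul_of_nonneg_left ?_ hωe.le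
        simpa only [Real.norm_eq_abs] using norm_tsum_le_tsum_norm hsnorm
    _ = ∑' k, ω e * |f U k - f U' k| := by rw [tsum_mul_left]
    _ ≤ ∑' k : ℕ, C * (((k : ℝ) + 1) * r ^ k) * M := Summable.tsum_le_tsum hdiff (hsabs.mul_left (ω e)) hgs.summable
    _ = C / (1 - r) ^ 2 * M := by rw [hgs.tsum_eq]; ring

/-- **Sup bound `M_Z` for the strong-coupling trivializing flow, colour components**:
`|∂^a_e S̃^G_t(ιU)| ≤ |β| N₀ / (1 − 2|β|θ₁)` for `|β| < β₀`, every `t`, `U`, `L`. [ours] -/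
theorem abs_linkDeriv_flowActionG_le (hn : n ≠ 0) (B : SuBasis n) {β : ℝ} (hβ : |β| < beta0 d n B)
    (t : ℝ) (U : GaugeConfig d L SU[n]) (e : Edge d L) (a : B.ι) :
    |linkDeriv e (B.T a) (flowActionG (d := d) (L := L) B β t) (coeConfig U)|
      ≤ |β| * N0 d n / (1 - 2 * |β| * theta1 d n B) := by
  set q : ℝ := 2 * |β| * theta1 d n B with hq
  have hθ : 0 ≤ theta1 d n B := zero_le_one.trans (one_le_theta1 d n B)
  have hq0 : 0 ≤ q := by positivity
  have hq1 : q < 1 := two_mul_abs_mul_theta1_lt_one (d := d) hn hβ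
  set f : ℕ → ℝ := fun k =>
    clamp t ^ k * (β ^ (k + 1) * linkDeriv e (B.T a) (gradedSk (d := d) (L := L) B k) (coeConfig U)) with hf
  have hterm : ∀ k, |f k| ≤ |β| * N0 d n * q ^ k := fun k => abs_clamp_pow_mul_linkDeriv_gradedSk_le hn B β t k U e a
  have hgeo : Summable (fun k => |β| * N0 d n * q ^ k) := (summable_geometric_of_lt_one hq0 hq1).mul_left _
  have habs : Summable (fun k => |f k|) := Summable.of_nonneg_of_le (fun _ => abs_nonneg _) hterm hgeo
  have hsnorm : Summable (fun k => ‖f k‖) := by simpa only [Real.norm_eq_abs] using habs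
  rw [linkDeriv_flowActionG_eq hn B hβ t U e a]
  change |∑' k, f k| ≤ |β| * N0 d n / (1 - q)
  calc |∑' k, f k| ≤ ∑' k, |f k| := by simpa only [Real.norm_eq_abs] using norm_tsum_le_tsum_norm hsnorm
    _ ≤ ∑' k, |β| * N0 d n * q ^ k := Summable.tsum_le_tsum hterm habs hgeo
    _ = |β| * N0 d n / (1 - q) := by rw [tsum_mul_left, tsum_geometric_of_lt_one hq0 hq1, div_eq_mul_inv]

/-- **`M_Z` (Frobenius form)**: `‖∂S̃^G_t(ιU)(e)‖_F ≤ M_G = |β| N₀ (1 − 2|β|θ₁)⁻¹ ∑ₐ ‖T^a‖_F`. [ours] -/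
theorem norm_linkGrad_flowActionG_le (hn : n ≠ 0) (B : SuBasis n) {β : ℝ} (hβ : |β| < beta0 d n B)
    (t : ℝ) (U : GaugeConfig d L SU[n]) (e : Edge d L) :
    ‖linkGrad B (flowActionG (d := d) (L := L) B β t) (coeConfig U) e‖ ≤ MG d n B β :=
  norm_linkGrad_le B _ _ e fun a => abs_linkDeriv_flowActionG_le hn B hβ t U e a

/-- **`K_Z(ω)` (Frobenius form) — the hypothesis `hZlip` of THEOREM L-ω for the strong-coupling
trivializing flow `Z_t = -∂S̃^G_t`**: `ω_e ‖Z_t(ιU)_e − Z_t(ιU')_e‖_F ≤ K_G(λ) M` whenever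
`ω_{e'}‖U_{e'} − U'_{e'}‖_F ≤ M` for all links. [ours] -/
theorem weighted_norm_linkGrad_flowActionG_sub_le (hn : n ≠ 0) (B : SuBasis n) {β : ℝ}
    (hβ : |β| < beta0 d n B) (ω : Edge d L → ℝ) (hω : ∀ e, 0 < ω e) {lam : ℝ} (hlam : 0 ≤ lam)
    (hωR : ∀ (R : ℕ) (e : Edge d L), ∀ e' ∈ linkBall R e, ω e ≤ lam ^ R * ω e')
    (hr : 2 * |β| * theta1 d n B * lam ^ 2 < 1) (t : ℝ) (e : Edge d L)
    (U U' : GaugeConfig d L SU[n]) {M : ℝ} (hM0 : 0 ≤ M) (hM : ∀ e', ω e' * ‖coeConfig U e' - coeConfig U' e'‖ ≤ M) :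
    ω e * ‖-linkGrad B (flowActionG (d := d) (L := L) B β t) (coeConfig U) e
        - -linkGrad B (flowActionG (d := d) (L := L) B β t) (coeConfig U') e‖ ≤ KG d n B β lam * M := by
  unfold KG
  have hωe : 0 < ω e := hω e
  set K : ℝ := 4 * n * N0 d n * |β| * lam ^ 2 / (1 - 2 * |β| * theta1 d n B * lam ^ 2) ^ 2 with hK
  have hcomp : ∀ a, |linkDeriv e (B.T a) (flowActionG (d := d) (L := L) B β t) (coeConfig U)
      - linkDeriv e (B.T a) (flowActionG (d := d) (L := L) B β t) (coeConfig U')| ≤ K * M / ω e := fun a => by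
    rw [le_div_iff₀ hωe, mul_comm]
    exact weighted_abs_linkDeriv_flowActionG_sub_le hn B hβ ω hω hlam hωR hr t e a U U' hM0 hM
  have h := norm_linkGrad_sub_linkGrad_le B (flowActionG (d := d) (L := L) B β t) (coeConfig U) (coeConfig U') e hcomp
  rw [neg_sub_neg, norm_sub_rev]
  calc ω e * ‖linkGrad B (flowActionG (d := d) (L := L) B β t) (coeConfig U) e
          - linkGrad B (flowActionG (d := d) (L := L) B β t) (coeConfig U') e‖
      ≤ ω e * (K * M / ω e * ∑ a, ‖B.T a‖) := mul_le_mul_of_nonneg_left h hωe.le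
    _ = (K * ∑ a, ‖B.T a‖) * M := by field_simp

/-! ## 5. THEOREM L-G: the exponential light cone of the strong-coupling trivializing flow -/

/-- **Weighted light cone of the strong-coupling trivializing flow.** For `|β| < β₀`, any flow `Φ` of
`Z_t = -∂S̃^G_t`, any weight `ω > 0` growing by at most `λ` per plaquette step (`λ ≥ 1`) with
`2|β|θ₁λ² < 1`: `ω_e ‖(Φ_t V)_e − (Φ_t V')_e‖_F ≤ δ e^{(nK_G(λ) + M_G) t}` on `[0, T]` whenever
`ω_e ‖V_e − V'_e‖_F ≤ δ` for all `e`. Every constant is independent of `L`. [ours] -/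
theorem weightedLightCone_flowG (hn : n ≠ 0) (B : SuBasis n) {β : ℝ} (hβ : |β| < beta0 d n B)
    {Φ : ℝ → GaugeConfig d L SU[n] → GaugeConfig d L SU[n]}
    (hΦ : IsFlowMap (fun t W => -linkGrad B (flowActionG (d := d) (L := L) B β t) W) Φ)
    (ω : Edge d L → ℝ) (hω : ∀ e, 0 < ω e) {lam : ℝ} (hlam : 1 ≤ lam)
    (hωg : ∀ e, ∀ e' ∈ plaqNbhd e, ω e ≤ lam * ω e') (hr : 2 * |β| * theta1 d n B * lam ^ 2 < 1)
    (T : ℝ) (V V' : GaugeConfig d L SU[n]) {δ : ℝ} (hδ : 0 ≤ δ) (hVV' : ∀ e, ω e * ‖coeConfig V e - coeConfig V' e‖ ≤ δ) :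
    ∀ t ∈ Set.Icc 0 T, ∀ e, ω e * ‖coeConfig (Φ t V) e - coeConfig (Φ t V') e‖ ≤
      δ * Real.exp ((n * KG d n B β lam + MG d n B β) * t) :=
  IsFlowMap.weightedLightCone hΦ ω hω (KG_nonneg d n B β lam) (MG_nonneg hn B hβ) T
    (fun t _ U U' e M hM0 hM => weighted_norm_linkGrad_flowActionG_sub_le hn B hβ ω hω (zero_le_one.trans hlam)
      (weight_le_pow_mul_of_mem_linkBall ω hω hlam hωg) hr t e U U' hM0 hM)
    (fun t _ U e => by rw [Pi.neg_apply, norm_neg]; exact norm_linkGrad_flowActionG_le hn B hβ t U e) V V' hδ hVV'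

/-- **THEOREM L-G — exponential light cone of the strong-coupling trivializing flow, uniformly in the
volume.** For `|β| < β₀(d,n,B)`, any flow `Φ` of `Z_t = -∂S̃^G_t`, any `λ ≥ 1` with `2|β|θ₁λ² < 1`,
any level function (`lvl e ≤ lvl e' + 1` across a plaquette) and inputs `V, V'` that agree at all links
of level `≥ 1`:  `‖(Φ_t V)_e − (Φ_t V')_e‖_F ≤ 2n · e^{(nK_G(λ)+M_G) t} / λ^{lvl e}` on `[0, T]`.
[ours; cf. Luscher2010Trivializing §3.2/§4.5(b), Raz–Sims arXiv:0902.0025 Thm. 2] -/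
theorem expLightCone_flowG (hn : n ≠ 0) (B : SuBasis n) {β : ℝ} (hβ : |β| < beta0 d n B)
    {Φ : ℝ → GaugeConfig d L SU[n] → GaugeConfig d L SU[n]}
    (hΦ : IsFlowMap (fun t W => -linkGrad B (flowActionG (d := d) (L := L) B β t) W) Φ)
    {lam : ℝ} (hlam : 1 ≤ lam) (hr : 2 * |β| * theta1 d n B * lam ^ 2 < 1)
    (lvl : Edge d L → ℕ) (hlvl : ∀ e, ∀ e' ∈ plaqNbhd e, lvl e ≤ lvl e' + 1) (T : ℝ)
    (V V' : GaugeConfig d L SU[n]) (hVV' : ∀ e, 1 ≤ lvl e → V e = V' e) :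
    ∀ t ∈ Set.Icc 0 T, ∀ e, ‖coeConfig (Φ t V) e - coeConfig (Φ t V') e‖ ≤
      2 * n * Real.exp ((n * KG d n B β lam + MG d n B β) * t) / lam ^ lvl e := by
  have hlam0 : 0 < lam := zero_lt_one.trans_le hlam
  set ω : Edge d L → ℝ := fun e => lam ^ lvl e with hω_def
  have hω : ∀ e, 0 < ω e := fun e => pow_pos hlam0 _
  have hωg : ∀ e, ∀ e' ∈ plaqNbhd e, ω e ≤ lam * ω e' := pow_level_le_mul_of_mem_plaqNbhd hlam lvl hlvl
  have hle : ∀ (U : GaugeConfig d L SU[n]) (e : Edge d L), ‖coeConfig U e‖ ≤ n := fun U e => by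
    rw [coeConfig_apply]; exact frobenius_norm_coe_SU_le (U e)
  have hδ : (0 : ℝ) ≤ 2 * n := by positivity
  have h0 : ∀ e, ω e * ‖coeConfig V e - coeConfig V' e‖ ≤ 2 * n := by
    intro e
    rcases Nat.eq_zero_or_pos (lvl e) with h | h
    · have hω1 : ω e = 1 := by rw [hω_def]; simp only [h, pow_zero]
      rw [hω1, one_mul]
      calc ‖coeConfig V e - coeConfig V' e‖ ≤ ‖coeConfig V e‖ + ‖coeConfig V' e‖ := norm_sub_le _ _
        _ ≤ n + n := add_le_add (hle V e) (hle V' e)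
        _ = 2 * n := by ring
    · rw [coeConfig_apply, coeConfig_apply, hVV' e h, sub_self, norm_zero, mul_zero]; exact hδ
  intro t ht e
  rw [le_div_iff₀ (hω e), mul_comm]
  exact weightedLightCone_flowG hn B hβ hΦ ω hω hlam hωg hr T V V' hδ h0 t ht e

/-- **A trivializing map of `β·S_W` with an exponential light cone, at every volume** (`|β| < β₀`):
lean-2's `exists_trivializingFlow_smul_ambWilsonAction` combined with THEOREM L-G at `t = 1`. The output
link of `Φ_1` at level `m` (plaquette distance `≥ m` from the links where the inputs differ) moves by at
most `2n e^{nK_G(λ)+M_G} λ^{-m}`: receptive depth `(nK_G(λ) + M_G + log(2n/ε))/log λ` plaquette steps for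
accuracy `ε`, INDEPENDENT OF `L`. [ours] -/
theorem exists_trivializingMap_expLightCone (hn : n ≠ 0) (B : SuBasis n) {β : ℝ} (hβ : |β| < beta0 d n B) :
    ∃ Φ : ℝ → GaugeConfig d L SU[n] → GaugeConfig d L SU[n],
      IsTrivializingMap (fun U : GaugeConfig d L SU[n] => β * ambWilsonAction (coeConfig U)) (Φ 1) ∧
      ∀ (lam : ℝ), 1 ≤ lam → 2 * |β| * theta1 d n B * lam ^ 2 < 1 →
        ∀ (lvl : Edge d L → ℕ), (∀ e, ∀ e' ∈ plaqNbhd e, lvl e ≤ lvl e' + 1) →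
        ∀ (V V' : GaugeConfig d L SU[n]), (∀ e, 1 ≤ lvl e → V e = V' e) →
          ∀ e, ‖coeConfig (Φ 1 V) e - coeConfig (Φ 1 V') e‖ ≤
            2 * n * Real.exp (n * KG d n B β lam + MG d n B β) / lam ^ lvl e := by
  obtain ⟨Φ, hΦ, -, -, htriv⟩ := exists_trivializingFlow_smul_ambWilsonAction (d := d) (L := L) hn B hβ
  refine ⟨Φ, htriv, fun lam hlam hr lvl hlvl V V' hVV' e => ?_⟩
  have h := expLightCone_flowG hn B hβ hΦ hlam hr lvl hlvl 1 V V' hVV' 1 ⟨zero_le_one, le_refl 1⟩ e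
  rwa [mul_one] at h

end StrongCoupling

end Summit.Ventures.LatticeQCDFlow.TrivializingMaps
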